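import Mathlib

/-!
# The stationary law of the pair-carry chain (stub `stub_stationary`)

The stub `stub_stationary` of the crux `MobiusLadder.QuadraticDigitPhases`
(stmt-QuantumAdvantage-1391), line `Sketch`, with its (elementary) lemmas.  Mathlib only.
The untwisted transfer matrix `U` of the pair-carry chain of `T ↦ (pT, qT)` moves the state
`(r, r') ∈ [0,p) × [0,q)` by the digit `t ∈ {0,1}` to `(⌊(pt + r)/2⌋, ⌊(qt + r')/2⌋)`, each with
probability `1/2` (`U_nonneg`, `U_row`).  Feeding the `n` digits of `T < 2^n` moves `(r, r')` to
`(⌊(pT + r)/2^n⌋, ⌊(qT + r')/2^n⌋)` with weight `2^{-n}` (`path_lower`), so `L = p + q` zero digits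
send every state to `(0,0)`: every row of `U^L` puts mass `≥ 2^{-L}` on `(0,0)` (DOEBLIN), hence
`U^L` contracts mass-zero row vectors in `ℓ¹` by `1 - 2^{-L}` (`doeblin`, `contract_pow`).  An
invariant probability vector `π` exists by linear algebra (`exists_invariant`); the contraction
gives `‖e_x U^k - π‖₁ ≤ 2 (1 - 2^{-L})^{⌊k/L⌋}` for every state `x`, whence `π` vanishes off the
reachable states `(⌊pT/2^c⌋, ⌊qT/2^c⌋)` (the rows of `U^k` at `(0,0)` live there, `reach_pow`) and
is `≥ 2^{-L-c} > 0` on them (`path_lower`, invariance).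
-/

set_option linter.dupNamespace false -- D-0017: single-problem summit ⇒ `QuantumAdvantage.QuantumAdvantage` by design

namespace Summit.QuantumAdvantage.QuantumAdvantage.Theorems.MobiusLadderQuadraticDigitPhasesStubStationary

open Finset
open scoped Matrix

section Markov

variable {ι : Type*} [Fintype ι]

-- adapted from …StubWordDecayOfUWC.l1_vecMul_le (all states, Mathlib-only copy)
/-- `ℓ¹ → ℓ¹` bound for row vectors: if all rows of `W` have absolute row sums `≤ K`, then
`‖v W‖₁ ≤ K ‖v‖₁`. -/
theorem l1_vecMul_le (W : Matrix ι ι ℝ) (K : ℝ) (hW : ∀ x, ∑ y, |W x y| ≤ K) (v : ι → ℝ) :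
    ∑ y, |(v ᵥ* W) y| ≤ K * ∑ x, |v x| := by
  simp only [Matrix.vecMul, dotProduct]
  calc ∑ y, |∑ x, v x * W x y| ≤ ∑ y, ∑ x, |v x| * |W x y| := Finset.sum_le_sum fun y _ =>
        (Finset.abs_sum_le_sum_abs _ _).trans_eq (Finset.sum_congr rfl fun x _ => abs_mul _ _)
    _ = ∑ x, |v x| * ∑ y, |W x y| := by rw [Finset.sum_comm]; simp_rw [Finset.mul_sum]
    _ ≤ ∑ x, |v x| * K :=
        Finset.sum_le_sum fun x _ => mul_le_mul_of_nonneg_left (hW x) (abs_nonneg _)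
    _ = K * ∑ x, |v x| := by rw [← Finset.sum_mul, mul_comm]

/-- Row-stochastic matrices preserve the total mass of row vectors. -/
theorem sum_vecMul (W : Matrix ι ι ℝ) (hrow : ∀ x, ∑ y, W x y = 1) (v : ι → ℝ) :
    ∑ y, (v ᵥ* W) y = ∑ x, v x := by
  simp only [Matrix.vecMul, dotProduct]
  rw [Finset.sum_comm]
  exact Finset.sum_congr rfl fun x _ => by rw [← Finset.mul_sum, hrow, mul_one]

variable [DecidableEq ι]

/-- Powers of a nonnegative row-stochastic matrix are nonnegative and row-stochastic. -/
theorem pow_stoch (W : Matrix ι ι ℝ) (h0 : ∀ x y, 0 ≤ W x y) (hrow : ∀ x, ∑ y, W x y = 1)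
    (k : ℕ) : (∀ x y, 0 ≤ (W ^ k) x y) ∧ (∀ x, ∑ y, (W ^ k) x y = 1) := by
  induction k with
  | zero =>
    refine ⟨fun x y => ?_, fun x => by simp_rw [pow_zero, Matrix.one_apply, sum_ite_eq, if_pos (mem_univ x)]⟩
    rw [pow_zero, Matrix.one_apply]
    split_ifs <;> norm_num
  | succ k ih =>
    refine ⟨fun x y => ?_, fun x => ?_⟩
    · rw [pow_succ, Matrix.mul_apply]
      exact Finset.sum_nonneg fun z _ => mul_nonneg (ih.1 x z) (h0 z y)
    · simp_rw [pow_succ, Matrix.mul_apply]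
      rw [Finset.sum_comm]
      simp_rw [← Finset.mul_sum, hrow, mul_one]
      exact ih.2 x

/-- DOEBLIN CONTRACTION: a nonnegative row-stochastic matrix all of whose rows put mass `≥ δ` on a
fixed state `y₀` contracts the `ℓ¹`-norm of mass-zero row vectors by the factor `1 - δ`
(subtract `δ` from the column `y₀`: a mass-zero vector does not see the difference, and the
modified matrix is nonnegative with row sums `1 - δ`). -/
theorem doeblin (W : Matrix ι ι ℝ) (h0 : ∀ x y, 0 ≤ W x y) (hrow : ∀ x, ∑ y, W x y = 1) (y₀ : ι)
    (δ : ℝ) (hδ : ∀ x, δ ≤ W x y₀) (v : ι → ℝ) (hv : ∑ x, v x = 0) :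
    ∑ y, |(v ᵥ* W) y| ≤ (1 - δ) * ∑ x, |v x| := by
  have hW : v ᵥ* W = v ᵥ* Matrix.of fun x y => W x y - if y = y₀ then δ else 0 := by
    funext y
    change ∑ x, v x * W x y = ∑ x, v x * (W x y - if y = y₀ then δ else 0)
    simp_rw [mul_sub, Finset.sum_sub_distrib, ← Finset.sum_mul, hv, zero_mul, sub_zero]
  rw [hW]
  refine l1_vecMul_le _ (1 - δ) (fun x => ?_) v
  simp only [Matrix.of_apply]
  rw [Finset.sum_congr rfl fun y _ => abs_of_nonneg ?_, Finset.sum_sub_distrib, hrow,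
    Finset.sum_ite_eq' Finset.univ y₀ (fun _ => δ), if_pos (Finset.mem_univ _)]
  split_ifs with h
  · subst h
    linarith [hδ x]
  · linarith [h0 x y]

/-- Iterated contraction: if `W^L` is a Doeblin matrix with constant `δ ≤ 1`, then
`‖v W^(L n + r)‖₁ ≤ (1 - δ)^n ‖v‖₁` for mass-zero row vectors `v`. -/
theorem contract_pow (W : Matrix ι ι ℝ) (h0 : ∀ x y, 0 ≤ W x y) (hrow : ∀ x, ∑ y, W x y = 1)
    (y₀ : ι) (δ : ℝ) (hδ1 : δ ≤ 1) (L : ℕ) (hδ : ∀ x, δ ≤ (W ^ L) x y₀) (n r : ℕ) (v : ι → ℝ)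
    (hv : ∑ x, v x = 0) : ∑ y, |(v ᵥ* W ^ (L * n + r)) y| ≤ (1 - δ) ^ n * ∑ x, |v x| := by
  induction n generalizing v with
  | zero =>
    obtain ⟨h0r, hrowr⟩ := pow_stoch W h0 hrow r
    rw [pow_zero, mul_zero, zero_add]
    exact l1_vecMul_le (W ^ r) 1
      (fun x => by rw [Finset.sum_congr rfl fun y _ => abs_of_nonneg (h0r x y), hrowr]) v
  | succ n ih =>
    rw [show L * (n + 1) + r = L + (L * n + r) by ring, pow_add, ← Matrix.vecMul_vecMul]
    obtain ⟨h0L, hrowL⟩ := pow_stoch W h0 hrow L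
    refine (ih (v ᵥ* W ^ L) (by rw [sum_vecMul _ hrowL, hv])).trans ?_
    rw [pow_succ, mul_assoc]
    exact mul_le_mul_of_nonneg_left (doeblin (W ^ L) h0L hrowL y₀ δ hδ v hv)
      (pow_nonneg (sub_nonneg.mpr hδ1) n)

/-- A nonnegative row-stochastic matrix has an invariant probability row vector: `(W - 1) 𝟙 = 0`,
so `W - 1` is singular and has a left null vector `v ≠ 0`; then `|v| W ≥ |v W| = |v|` entrywise
with equal total mass, so `|v|` is invariant, and `π = |v| / ‖v‖₁`. -/
theorem exists_invariant [Nonempty ι] (W : Matrix ι ι ℝ) (h0 : ∀ x y, 0 ≤ W x y)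
    (hrow : ∀ x, ∑ y, W x y = 1) :
    ∃ π : ι → ℝ, (∀ x, 0 ≤ π x) ∧ ∑ x, π x = 1 ∧ π ᵥ* W = π := by
  have h1 : (W - 1) *ᵥ (fun _ => (1 : ℝ)) = 0 := by
    funext x
    rw [Matrix.sub_mulVec, Matrix.one_mulVec, Pi.sub_apply]
    change ∑ y, W x y * 1 - 1 = 0
    simp_rw [mul_one, hrow x, sub_self]
  have hdet : (W - 1).det = 0 := Matrix.exists_mulVec_eq_zero_iff.mp
    ⟨_, fun h => one_ne_zero (congr_fun h (Classical.arbitrary ι)), h1⟩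
  obtain ⟨v, hv0, hv⟩ := Matrix.exists_vecMul_eq_zero_iff.mpr hdet
  rw [Matrix.vecMul_sub, Matrix.vecMul_one, sub_eq_zero] at hv
  have hle : ∀ y ∈ (Finset.univ : Finset ι), |v y| ≤ ∑ x, |v x| * W x y := fun y _ => by
    conv_lhs => rw [← hv]
    change |∑ x, v x * W x y| ≤ _
    refine (Finset.abs_sum_le_sum_abs _ _).trans_eq (Finset.sum_congr rfl fun x _ => ?_)
    rw [abs_mul, abs_of_nonneg (h0 x y)]
  have hsum : ∑ y, |v y| = ∑ y, ∑ x, |v x| * W x y := (sum_vecMul W hrow fun x => |v x|).symm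
  have heq := (Finset.sum_eq_sum_iff_of_le hle).mp hsum
  have hS : 0 < ∑ x, |v x| := by
    obtain ⟨x, hx⟩ := Function.ne_iff.mp hv0
    exact Finset.sum_pos' (fun x _ => abs_nonneg _) ⟨x, Finset.mem_univ _, abs_pos.mpr hx⟩
  refine ⟨fun x => |v x| / ∑ z, |v z|, fun x => div_nonneg (abs_nonneg _) hS.le, ?_, ?_⟩
  · rw [← Finset.sum_div, div_self hS.ne']
  · funext y
    change ∑ x, |v x| / (∑ z, |v z|) * W x y = |v y| / ∑ z, |v z|
    simp_rw [div_mul_eq_mul_div, ← Finset.sum_div]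
    rw [← heq y (Finset.mem_univ _)]

/-- An invariant row vector is invariant under all powers. -/
theorem vecMul_pow_of_inv (W : Matrix ι ι ℝ) (π : ι → ℝ) (hπ : π ᵥ* W = π) (k : ℕ) :
    π ᵥ* W ^ k = π := by
  induction k with
  | zero => rw [pow_zero, Matrix.vecMul_one]
  | succ k ih => rw [pow_succ', ← Matrix.vecMul_vecMul, hπ, ih]

end Markov

section Carry

-- adapted from …StubDwdOfWords.carry_succ / …StubWordDecayOfUWC.carry_step (with an offset `r`)
/-- Carry arithmetic of one digit move:
`⌊(p (2^c t + T) + r) / 2^{c+1}⌋ = ⌊(p t + ⌊(p T + r)/2^c⌋)/2⌋`. -/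
theorem carry_step (p c t T r : ℕ) :
    (p * (2 ^ c * t + T) + r) / 2 ^ (c + 1) = (p * t + (p * T + r) / 2 ^ c) / 2 := by
  rw [pow_succ, ← Nat.div_div_eq_div_mul,
    show p * (2 ^ c * t + T) + r = p * T + r + p * t * 2 ^ c by ring,
    Nat.add_mul_div_right _ _ (Nat.two_pow_pos c), Nat.add_comm ((p * T + r) / 2 ^ c)]

/-- Move targets are states: `⌊(pT + r)/N⌋ < p` for `T < N` and `r < p`. -/
theorem target_lt (p N T r : ℕ) (hN : 0 < N) (hT : T < N) (hr : r < p) : (p * T + r) / N < p := by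
  rw [Nat.div_lt_iff_lt_mul hN]
  calc p * T + r < p * T + p := by omega
    _ = p * (T + 1) := by ring
    _ ≤ p * N := Nat.mul_le_mul_left p hT

variable {p q : ℕ} (U : Matrix (Fin p × Fin q) (Fin p × Fin q) ℝ)
  (hU : U = Matrix.of fun (x y : Fin p × Fin q) =>
    ∑ t ∈ ({0, 1} : Finset ℕ),
      if (y.1 : ℕ) = (p * t + x.1) / 2 ∧ (y.2 : ℕ) = (q * t + x.2) / 2 then (1 / 2 : ℝ) else 0)
include hU

/-- The entries of `U` are nonnegative. -/
theorem U_nonneg (x y : Fin p × Fin q) : 0 ≤ U x y := by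
  rw [hU, Matrix.of_apply]
  exact Finset.sum_nonneg fun t _ => by split_ifs <;> norm_num

/-- `U` is row-stochastic: both digit moves land inside the state space, each with weight `1/2`. -/
theorem U_row (x : Fin p × Fin q) : ∑ y, U x y = 1 := by
  simp only [hU, Matrix.of_apply]
  rw [Finset.sum_comm, Finset.sum_pair zero_ne_one]
  have key : ∀ t : ℕ, t ≤ 1 → ∑ y : Fin p × Fin q,
      (if (y.1 : ℕ) = (p * t + x.1) / 2 ∧ (y.2 : ℕ) = (q * t + x.2) / 2 then (1 / 2 : ℝ) else 0)
        = 1 / 2 := by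
    intro t ht
    have h1 : (p * t + x.1) / 2 < p := target_lt p 2 t x.1 Nat.two_pos (by omega) x.1.isLt
    have h2 : (q * t + x.2) / 2 < q := target_lt q 2 t x.2 Nat.two_pos (by omega) x.2.isLt
    rw [Finset.sum_eq_single_of_mem ((Fin.mk _ h1, Fin.mk _ h2) : Fin p × Fin q) (Finset.mem_univ _)
      fun y _ hy => if_neg fun h => hy (Prod.ext (Fin.ext h.1) (Fin.ext h.2))]
    exact if_pos ⟨rfl, rfl⟩
  rw [key 0 zero_le_one, key 1 le_rfl]
  norm_num

/-- PATHS: feeding the `n` binary digits of `T < 2^n` moves `x = (r, r')` to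
`(⌊(pT + r)/2^n⌋, ⌊(qT + r')/2^n⌋)` with weight `2^{-n}`, so this entry of `U^n` is `≥ 2^{-n}`. -/
theorem path_lower (n : ℕ) : ∀ T : ℕ, T < 2 ^ n → ∀ x y : Fin p × Fin q,
    (y.1 : ℕ) = (p * T + x.1) / 2 ^ n → (y.2 : ℕ) = (q * T + x.2) / 2 ^ n →
    (1 / 2 : ℝ) ^ n ≤ (U ^ n) x y := by
  induction n with
  | zero =>
    intro T hT x y h1 h2
    have hT0 : T = 0 := by omega
    subst hT0
    rw [mul_zero, zero_add, pow_zero, Nat.div_one] at h1 h2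
    rw [pow_zero, pow_zero, show y = x from Prod.ext (Fin.ext h1) (Fin.ext h2), Matrix.one_apply_eq]
  | succ n ih =>
    intro T hT x y h1 h2
    obtain ⟨t, T', ht1, hT', rfl⟩ : ∃ t T' : ℕ, t ≤ 1 ∧ T' < 2 ^ n ∧ T = 2 ^ n * t + T' := by
      refine ⟨T / 2 ^ n, T % 2 ^ n, ?_, Nat.mod_lt _ (Nat.two_pow_pos n),
        (Nat.div_add_mod T (2 ^ n)).symm⟩
      have : T / 2 ^ n < 2 := by
        rw [Nat.div_lt_iff_lt_mul (Nat.two_pow_pos n), ← pow_succ']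
        exact hT
      omega
    set z : Fin p × Fin q := (Fin.mk _ (target_lt p _ T' x.1 (Nat.two_pow_pos n) hT' x.1.isLt),
      Fin.mk _ (target_lt q _ T' x.2 (Nat.two_pow_pos n) hT' x.2.isLt)) with hz
    have h0 := U_nonneg U hU
    have h0n := (pow_stoch U h0 (U_row U hU) n).1
    have hc : (y.1 : ℕ) = (p * t + z.1) / 2 ∧ (y.2 : ℕ) = (q * t + z.2) / 2 := by
      rw [h1, h2, carry_step, carry_step]
      exact ⟨rfl, rfl⟩
    have hstep : (1 / 2 : ℝ) ≤ U z y := by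
      rw [hU, Matrix.of_apply]
      have htmem : t ∈ ({0, 1} : Finset ℕ) := by
        rw [Finset.mem_insert, Finset.mem_singleton]
        omega
      refine le_of_eq_of_le (if_pos hc).symm (Finset.single_le_sum (f := fun t : ℕ =>
        if (y.1 : ℕ) = (p * t + z.1) / 2 ∧ (y.2 : ℕ) = (q * t + z.2) / 2 then (1 / 2 : ℝ) else 0)
        (fun s _ => ?_) htmem)
      split_ifs <;> norm_num
    calc (1 / 2 : ℝ) ^ (n + 1) = (1 / 2) ^ n * (1 / 2) := pow_succ _ _
      _ ≤ (U ^ n) x z * U z y := mul_le_mul (ih T' hT' x z rfl rfl) hstep (by norm_num) (h0n x z)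
      _ ≤ (U ^ (n + 1)) x y := by
        rw [pow_succ, Matrix.mul_apply]
        exact Finset.single_le_sum (f := fun w => (U ^ n) x w * U w y)
          (fun w _ => mul_nonneg (h0n x w) (h0 w y)) (Finset.mem_univ z)

-- adapted from …StubWordDecayOfUWC.reach_step (untwisted matrix)
/-- The reachable states `(⌊pT/2^c⌋, ⌊qT/2^c⌋)`, `T < 2^c`, are closed under the moves of `U`. -/
theorem reach_step (s y : Fin p × Fin q)
    (hs : ∃ c T : ℕ, T < 2 ^ c ∧ (s.1 : ℕ) = p * T / 2 ^ c ∧ (s.2 : ℕ) = q * T / 2 ^ c)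
    (h : U s y ≠ 0) :
    ∃ c T : ℕ, T < 2 ^ c ∧ (y.1 : ℕ) = p * T / 2 ^ c ∧ (y.2 : ℕ) = q * T / 2 ^ c := by
  rw [hU, Matrix.of_apply] at h
  obtain ⟨t, ht, hty⟩ := Finset.exists_ne_zero_of_sum_ne_zero h
  have hc : (y.1 : ℕ) = (p * t + s.1) / 2 ∧ (y.2 : ℕ) = (q * t + s.2) / 2 := by
    by_contra hc
    exact hty (if_neg hc)
  obtain ⟨c, T, hT, hs1, hs2⟩ := hs
  have ht1 : t ≤ 1 := by
    rw [Finset.mem_insert, Finset.mem_singleton] at ht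
    omega
  have h2 : 2 ^ c * t ≤ 2 ^ c := mul_le_of_le_one_right (Nat.zero_le _) ht1
  refine ⟨c + 1, 2 ^ c * t + T, ?_, ?_, ?_⟩
  · rw [pow_succ]
    omega
  · simpa only [hc.1, hs1, add_zero] using (carry_step p c t T 0).symm
  · simpa only [hc.2, hs2, add_zero] using (carry_step q c t T 0).symm

/-- Rows of `U^k` at reachable states are carried by reachable states. -/
theorem reach_pow (k : ℕ) : ∀ s y : Fin p × Fin q,
    (∃ c T : ℕ, T < 2 ^ c ∧ (s.1 : ℕ) = p * T / 2 ^ c ∧ (s.2 : ℕ) = q * T / 2 ^ c) →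
    (U ^ k) s y ≠ 0 → ∃ c T : ℕ, T < 2 ^ c ∧ (y.1 : ℕ) = p * T / 2 ^ c ∧ (y.2 : ℕ) = q * T / 2 ^ c := by
  induction k with
  | zero =>
    intro s y hs h
    rw [pow_zero] at h
    exact (show s = y from not_not.mp fun hne => h (Matrix.one_apply_ne hne)) ▸ hs
  | succ k ih =>
    intro s y hs h
    rw [pow_succ, Matrix.mul_apply] at h
    obtain ⟨z, -, hz⟩ := Finset.exists_ne_zero_of_sum_ne_zero h
    exact reach_step U hU z y (ih s z hs (left_ne_zero_of_mul hz)) (right_ne_zero_of_mul hz)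

/-- THE PACKAGE for an abstract `U`: an invariant probability vector `π` of `U`, positive exactly
on the reachable states, with uniform `ℓ¹`-convergence of the rows of `U^k` to `π`
(Doeblin: `L = p + q` zero digits reset every state to `(0,0)`). -/
theorem stationary_pkg (hp : 0 < p) (hq : 0 < q) :
    ∃ π : Fin p × Fin q → ℝ,
      (∀ s : Fin p × Fin q, (∃ c T : ℕ, T < 2 ^ c ∧ (s.1 : ℕ) = p * T / 2 ^ c ∧
        (s.2 : ℕ) = q * T / 2 ^ c) → 0 < π s) ∧
      (∀ s : Fin p × Fin q, ¬ (∃ c T : ℕ, T < 2 ^ c ∧ (s.1 : ℕ) = p * T / 2 ^ c ∧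
        (s.2 : ℕ) = q * T / 2 ^ c) → π s = 0) ∧
      (∑ s : Fin p × Fin q, π s = 1) ∧
      (∀ y : Fin p × Fin q, ∑ x : Fin p × Fin q, π x * U x y = π y) ∧
      (∀ ε : ℝ, 0 < ε → ∃ G : ℕ, ∀ k : ℕ, G ≤ k → ∀ x : Fin p × Fin q,
        (∃ c T : ℕ, T < 2 ^ c ∧ (x.1 : ℕ) = p * T / 2 ^ c ∧ (x.2 : ℕ) = q * T / 2 ^ c) →
        ∑ y : Fin p × Fin q, |(U ^ k) x y - π y| ≤ ε) := by
  have h0 := U_nonneg U hU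
  have hrow := U_row U hU
  set y₀ : Fin p × Fin q := (⟨0, hp⟩, ⟨0, hq⟩) with hy₀
  have hRy₀ : ∃ c T : ℕ, T < 2 ^ c ∧ (y₀.1 : ℕ) = p * T / 2 ^ c ∧ (y₀.2 : ℕ) = q * T / 2 ^ c :=
    ⟨0, 0, Nat.one_pos, by simp [hy₀], by simp [hy₀]⟩
  haveI : Nonempty (Fin p × Fin q) := ⟨y₀⟩
  obtain ⟨π, hπ0, hπ1, hπU⟩ := exists_invariant U h0 hrow
  have hπk := vecMul_pow_of_inv U π hπU
  have hπk' : ∀ (k : ℕ) (y : Fin p × Fin q), π y = ∑ x, π x * (U ^ k) x y := fun k y =>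
    (congr_fun (hπk k) y).symm
  -- Doeblin: `L = p + q` zero digits reset every state
  set L : ℕ := p + q with hL
  have h2L : ∀ m : ℕ, m ≤ L → m < 2 ^ L := fun m hm =>
    Nat.lt_two_pow_self.trans_le (Nat.pow_le_pow_right Nat.two_pos hm)
  have hδ : ∀ x, (1 / 2 : ℝ) ^ L ≤ (U ^ L) x y₀ := fun x =>
    path_lower U hU L 0 (Nat.two_pow_pos L) x y₀
      (by rw [mul_zero, zero_add, Nat.div_eq_of_lt (x.1.isLt.trans (h2L p (by omega)))])
      (by rw [mul_zero, zero_add, Nat.div_eq_of_lt (x.2.isLt.trans (h2L q (by omega)))])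
  have hδ1 : (1 / 2 : ℝ) ^ L ≤ 1 := pow_le_one₀ (by norm_num) (by norm_num)
  have hcontr := contract_pow U h0 hrow y₀ ((1 / 2 : ℝ) ^ L) hδ1 L hδ
  -- uniform `ℓ¹` convergence of ALL rows of `U^k` to `π`
  have hrate : ∀ ε : ℝ, 0 < ε → ∃ G : ℕ, ∀ k : ℕ, G ≤ k → ∀ x : Fin p × Fin q,
      ∑ y, |(U ^ k) x y - π y| ≤ ε := by
    intro ε hε
    have hK1 : 1 - (1 / 2 : ℝ) ^ L < 1 := by linarith [pow_pos (show (0 : ℝ) < 1 / 2 by norm_num) L]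
    obtain ⟨n, hn⟩ := exists_pow_lt_of_lt_one (half_pos hε) hK1
    refine ⟨L * n, fun k hk x => ?_⟩
    obtain ⟨r, rfl⟩ : ∃ r, k = L * n + r := ⟨k - L * n, by omega⟩
    set v : Fin p × Fin q → ℝ := Pi.single x 1 - π with hv
    have hv0 : ∑ y, v y = 0 := by
      simp only [hv, Pi.sub_apply, sum_sub_distrib, hπ1, sum_pi_single', mem_univ, if_true, sub_self]
    have hv2 : ∑ y, |v y| ≤ 2 := by
      calc ∑ y, |v y| ≤ ∑ y, (|(Pi.single x 1 : Fin p × Fin q → ℝ) y| + |π y|) :=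
            sum_le_sum fun y _ => by rw [hv, Pi.sub_apply]; exact abs_sub _ _
        _ = 2 := by
          rw [sum_add_distrib, sum_congr rfl fun y _ => abs_of_nonneg (hπ0 y), hπ1,
            sum_eq_single_of_mem x (mem_univ _) fun y _ hy => by rw [Pi.single_eq_of_ne hy, abs_zero],
            Pi.single_eq_same, abs_one]
          norm_num
    have hvk : ∀ y, (v ᵥ* U ^ (L * n + r)) y = (U ^ (L * n + r)) x y - π y := fun y => by
      rw [hv, Matrix.sub_vecMul, hπk, Pi.sub_apply, Matrix.single_one_vecMul, Matrix.row_apply]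
    calc ∑ y, |(U ^ (L * n + r)) x y - π y| = ∑ y, |(v ᵥ* U ^ (L * n + r)) y| := by
          simp_rw [hvk]
      _ ≤ (1 - (1 / 2 : ℝ) ^ L) ^ n * ∑ y, |v y| := hcontr n r v hv0
      _ ≤ (1 - (1 / 2 : ℝ) ^ L) ^ n * 2 :=
          mul_le_mul_of_nonneg_left hv2 (pow_nonneg (sub_nonneg.mpr hδ1) n)
      _ ≤ ε := by linarith [hn]
  refine ⟨π, fun s hs => ?_, fun s hs => ?_, hπ1, fun y => congr_fun hπU y, fun ε hε => ?_⟩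
  · -- positivity on the reachable states
    obtain ⟨c, T, hT, hs1, hs2⟩ := hs
    have hcs : (1 / 2 : ℝ) ^ c ≤ (U ^ c) y₀ s :=
      path_lower U hU c T hT y₀ s (by rw [hs1, hy₀, add_zero]) (by rw [hs2, hy₀, add_zero])
    have hy₀L : (1 / 2 : ℝ) ^ L ≤ π y₀ :=
      calc (1 / 2 : ℝ) ^ L = ∑ x, π x * (1 / 2) ^ L := by rw [← Finset.sum_mul, hπ1, one_mul]
        _ ≤ ∑ x, π x * (U ^ L) x y₀ :=
            Finset.sum_le_sum fun x _ => mul_le_mul_of_nonneg_left (hδ x) (hπ0 x)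
        _ = π y₀ := (hπk' L y₀).symm
    calc (0 : ℝ) < (1 / 2) ^ L * (1 / 2) ^ c := by positivity
      _ ≤ π y₀ * (U ^ c) y₀ s := mul_le_mul hy₀L hcs (by positivity) (hπ0 _)
      _ ≤ π s := by
          rw [hπk' c s]
          exact Finset.single_le_sum (f := fun x => π x * (U ^ c) x s)
            (fun x _ => mul_nonneg (hπ0 x) ((pow_stoch U h0 hrow c).1 x s)) (Finset.mem_univ y₀)
  · -- vanishing off the reachable states: compare with the row of `U^k` at `(0,0)`
    by_contra hne
    have hpos : 0 < |π s| := abs_pos.mpr hne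
    obtain ⟨G, hG⟩ := hrate (|π s| / 2) (half_pos hpos)
    have hG0 : (U ^ G) y₀ s = 0 := by
      by_contra hG0
      exact hs (reach_pow U hU G y₀ s hRy₀ hG0)
    have key : |π s| ≤ |π s| / 2 :=
      calc |π s| = |(U ^ G) y₀ s - π s| := by rw [hG0, zero_sub, abs_neg]
        _ ≤ ∑ y, |(U ^ G) y₀ y - π y| :=
            Finset.single_le_sum (f := fun y => |(U ^ G) y₀ y - π y|) (fun y _ => abs_nonneg _)
              (Finset.mem_univ s)
        _ ≤ |π s| / 2 := hG G le_rfl y₀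
    linarith
  · obtain ⟨G, hG⟩ := hrate ε hε
    exact ⟨G, fun k hk x _ => hG k hk x⟩

end Carry

/-- THE STATIONARY PACKAGE (stub `stub_stationary` of the crux, line `Sketch`): the untwisted
pair-carry transfer matrix `U` (digit `t ∈ {0,1}` moves `(r, r')` to `(⌊(pt + r)/2⌋, ⌊(qt + r')/2⌋)`
with probability `1/2`) has an invariant probability vector `π`, positive exactly on the states
`(⌊pT/2^c⌋, ⌊qT/2^c⌋)` reachable from `(0,0)`, and the rows of `U^k` at reachable states converge
to `π` in `ℓ¹`, uniformly.  Proof: `stationary_pkg` (Doeblin contraction of `U^{p+q}`). -/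
theorem stub_stationary :
    ∀ p q : ℕ, p.Prime → q.Prime → p ≠ q → 2 < p → 2 < q →
      (∃ π : Fin p × Fin q → ℝ,
        (∀ s : Fin p × Fin q, (∃ c T : ℕ, T < 2 ^ c ∧ (s.1 : ℕ) = p * T / 2 ^ c ∧ (s.2 : ℕ) = q * T / 2 ^ c) → 0 < π s) ∧
        (∀ s : Fin p × Fin q, ¬ (∃ c T : ℕ, T < 2 ^ c ∧ (s.1 : ℕ) = p * T / 2 ^ c ∧ (s.2 : ℕ) = q * T / 2 ^ c) → π s = 0) ∧
        (∑ s : Fin p × Fin q, π s = 1) ∧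
        (∀ y : Fin p × Fin q, ∑ x : Fin p × Fin q, π x * (Matrix.of fun (x y : Fin p × Fin q) =>
          ∑ t ∈ ({0, 1} : Finset ℕ),
            if (y.1 : ℕ) = (p * t + x.1) / 2 ∧ (y.2 : ℕ) = (q * t + x.2) / 2 then (1 / 2 : ℝ) else 0) x y = π y) ∧
        (∀ ε : ℝ, 0 < ε → ∃ G : ℕ, ∀ k : ℕ, G ≤ k → ∀ x : Fin p × Fin q, (∃ c T : ℕ, T < 2 ^ c ∧ (x.1 : ℕ) = p * T / 2 ^ c ∧ (x.2 : ℕ) = q * T / 2 ^ c) →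
          ∑ y : Fin p × Fin q, |((Matrix.of fun (x y : Fin p × Fin q) =>
          ∑ t ∈ ({0, 1} : Finset ℕ),
            if (y.1 : ℕ) = (p * t + x.1) / 2 ∧ (y.2 : ℕ) = (q * t + x.2) / 2 then (1 / 2 : ℝ) else 0) ^ k) x y - π y| ≤ ε)) :=
  fun _ _ hp hq _ _ _ => stationary_pkg _ rfl hp.pos hq.pos

end Summit.QuantumAdvantage.QuantumAdvantage.Theorems.MobiusLadderQuadraticDigitPhasesStubStationary
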